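import Summits.BirchSwinnertonDyer.Rank1Residual.ManinAdditive.MinusOneLevelRaisingOptimalPartnerProof
import HarnessLib

/-!
# THE GENERAL `χ₋₄` ROTATION LAW, the `8 ∥ N ⇝ 16 ∥ 2N` level-raising (E-an-148), and C2 reduced to `16 ∣ N`
# (cell bsd-f2-manin, seat -an, gen 32, MEMO-an §75.10; landing file B5 — requires B1–B4 landed: the first two imports
# are the intended tree homes of B3 `MinusOneLevelRaisingOptimalPartnerProof` and B4 `MinusOneLevelRaisingManinOddAtFourSplit`;
# B3 is LANDED (p695548, typer g17); B4 is the LEAD's.  Against the landed B1 (p694215, reduced) / B2 (p694844) / B3 (p695548):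
# the level-lift step uses the tree's S-an-56 `ManinLocalTwoThree.periodLattice_le_periodLattice_charTwist_one_of_two_dvd` (p2, p693677)
# and the datum step the tree's `PlusEtaManinInput.exists_modularParametrizationData_eq_of_smul_periodLattice_le` — exactly the typer's
# re-routings of B3.  Checked as HOME/an/g32/MinusOneLevelRaisingProofs_concat8.lean = B4 body + this file's body importing the TREE's B3
# (rc 0 · errors 0 · warnings 0 · sorries 0, `--axioms maninOddAtFour_of_maninOddAtSixteen` standard).)

ONE theorem `minusOneTwistRotation_general` — for `W ⊗ χ₋₄ ~ W′`, `4 ∣ N(W)`, `16 ∣ N(W′)`, `N(W) ∣ N(W′) ∣ 4N(W)`,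
ANY `Γ₀`-data at the conductors: `Λ(f_{W′}) = i·Λ(f_W)` — covers the tree's THEOREM I (`N′ = N`, `16 ∣ N`), E-an-145
(`N′ = 4N`, `4 ∥ N`) and the NEW law E-an-148 (`N′ = 2N`, `8 ∥ N`: the fate of every `8 ∥ N` optimal class).  With the
tree's level-agnostic edges (`optimalTwistRigidity_of_rot`, `optimal_c_eq_or_of_rot_of_four_dvd`): optimality commutes,
`c′ = ±c`.  The general partner construction `exists_optimalPartner_general` (mod `exists_isNewformOf`) then reduces the
conductor-level `2 ∤ c` statement on `8 ∥ N` to `16 ∣ N` given the print conductor fact S-an-60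
`NegOneTwistConductorTwoMul` (`f₂ = 3 ⇒ f₂(⊗χ₋₄) = 4`), and the ROUTE CRUX C2 splits in the kernel as
`NegOneTwistConductorFourMul → NegOneTwistConductorTwoMul → ManinOddAtSixteen → ManinOddAtFour`.
TWISTCENSUS2 (all 897 670 optimal additive-at-2 classes `≤ 5·10⁵`, `χ₋₄`-patterns `(v₂N, v₂N′)`): `(2,4)` 168 649 ·
`(3,4)` 168 136 · `(4,0)` 29 612 · `(4,1)` 104 447 · `(4,2)` 43 845 · `(4,3)` 85 778 · `(5,5)` 79 015 · `(6,6)` 167 088 ·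
`(7,7)` 35 404 · `(8,8)` 15 696, nothing else; laws (optimality commutes, `deg′·N = deg·N′`, `Δ′ = Δ`) hold on every
in-range pair of every pattern (zero failures; `(3,4)`: 85 778/85 778 ×3).
PARTITION 0 · C2 is NOT proved here (`ManinOddAtSixteen` is open) · BSD is not proved by this; Manin's conjecture is
not proved by this.  References: [Stevens1989] (5.4); [Cremona1997] §2.8; [Pal2012] 3.1/2.4; [Serre1987] §4;
[Katz1988] ch. 1; [BarriosEtAl2025] Thm. 5.1; [AtkinLehner1970] Thm. 4.

TYPER NOTE (typer g17, TURNKEY-an-25, PART B5a = 1/3).  an's landing file HOME/an/g32/MinusOneLevelRaisingGeneralProof.lean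
sha16 57aa2c9e76daaa63 (655 l.; checked by an against the LANDED B1–B3 + B4 body as MinusOneLevelRaisingProofs_concat7b.lean
1db369f22e5dcf63: rc 0 · 0 err · 0 warn · 0 sorry, axioms standard) exceeds the gate's 400-line cap for theorem-bearing
leaves, so the typer split it VERBATIM into three siblings: **B5a (this file) = §9 `GeneralRotation` + `LevelRaisingByTwo`**
(`half_gaussSum_χ₄_twoSided_general`, `minusOneTwistRotation_general`, `minusOneTwistOptimalOrbit_general`,
`minusOneTwistRotation_sameLevel`; nodes E-an-148 `MinusOneLevelRaisingByTwoLatticeRotation` / E-an-148R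
`MinusOneLevelRaisingByTwoOptimalOrbit` and their `_holds`, `levelRaisingByTwo_two_not_dvd_c_iff`); B5b =
`MinusOneLevelRaisingSixteenSplit.lean` (§9 `GeneralPartner` + §9bis `SplitSixteen`: S-an-60/61/62 nodes, partner
construction, C2 ⟸ C2|_{16∣N}); B5c = `MinusOneLevelRaisingGeneralDegree.lean` (§10 `DegreeGeneral`: E-an-148D).  Omitted as
`dedup.landed` re-derivations: `minusOneTwistRotation_fourMul` (= p2's p693677 statement) and `minusOneLevelRaisingDegree_holds'`
(= B2's `minusOneLevelRaisingDegree_holds`).  This part imports only the landed B3; B4 and the Theses file are imported by B5b.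
bears_on: stmt-BirchSwinnertonDyer-22967 (C2).  BSD is not proved by this; Manin's conjecture is not proved by this; C2/C3 OPEN.
-/

set_option autoImplicit false

noncomputable section

open scoped MatrixGroups ModularForm
open CongruenceSubgroup WeierstrassCurve
  Literature.NumberTheory.DiophantineGeometry
  Literature.NumberTheory.EllipticCurves
  Literature.NumberTheory.EllipticCurves.ModularForms
  Summit.BirchSwinnertonDyer.BirchSwinnertonDyer.Theorems

namespace Summit.BirchSwinnertonDyer.Rank1Residual.ManinAdditive

/-! ## §9 THE GENERAL `χ₋₄` ROTATION LAW and the `8 ∥ N ⇝ 16 ∥ 2N` level-raising (E-an-148); C2 ⟸ C2|_{16 ∣ N}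

One theorem covers THEOREM I (same level, `16 ∣ N`), E-an-145 (`4 ∥ N ⇝ 4N`) and the NEW law E-an-148
(`8 ∥ N ⇝ 2N`): for `W ⊗ χ₋₄ ~ W′` with `4 ∣ N(W)`, `16 ∣ N(W′)`, `N(W) ∣ N(W′) ∣ 4·N(W)`:
`Λ(f_{W′}) = i·Λ(f_W)`; for lattice-optimal data optimality commutes and `c′ = ±c` (tree edges, level-agnostic).
TWISTCENSUS2 (`χ₋₄`-patterns `(v₂N, v₂N′)` over all 897 670 optimal additive-at-2 classes `≤ 5·10⁵`):
`(2,4)` 168 649 · `(3,4)` 168 136 · `(4,0)` 29 612 · `(4,1)` 104 447 · `(4,2)` 43 845 · `(4,3)` 85 778 ·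
`(5,5)` 79 015 · `(6,6)` 167 088 · `(7,7)` 35 404 · `(8,8)` 15 696 — nothing else; in particular EVERY `8 ∥ N`
class raises to `16 ∥ 2N` and NO `16 ∥ N` class is `χ₋₄`-stable.  On the 85 778 in-range `(3,4)` pairs:
optimality commutes 85 778/85 778, `deg′ = 2·deg` 85 778/85 778, `Δ′ = Δ` 85 778/85 778 (g32/gen_rotation_check.out).
PARTITION 0 · beyond-print theorem: yes · C2 NOT proved · BSD is not proved by this. -/

section GeneralRotation

/-- **The general two-sided exact step.** For `W ⊗ χ₋₄ ~ W′`, `4 ∣ N(W)`, `16 ∣ N(W′)`,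
`N(W) ∣ N(W′)`, `N(W′) ∣ 4N(W)`, ANY `Γ₀(N(W))`-datum `D` of `W` and ANY newform `g` of `W′` at level `N(W′)`:
`(g(χ₄)/2)·Λ(g) ⊆ Λ(f_W)` and `(g(χ₄)/2)·Λ(f_W) ⊆ Λ(g)`.  (§7's proof with the level relation relaxed to the two
divisibilities it actually uses: `charTwist` to level `N(W′)` needs `N(W) ∣ N(W′)` and `16 ∣ N(W′)`; the level-lift
S-an-56 needs `N(W′) ∣ 4N(W)` and `2 ∣ N(W)`.) [cite: Stevens1989, Lemma (5.4) p. 97] [cite: Cremona1997, §2.8] -/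
theorem half_gaussSum_χ₄_twoSided_general {W W' : WeierstrassCurve ℚ}
    [W.IsElliptic] [W'.IsElliptic] [NeZero (W.conductorNorm ℤ)] [NeZero (W'.conductorNorm ℤ)]
    (D : ModularParametrizationData W (W.conductorNorm ℤ))
    (g : CuspForm (Gamma0 (W'.conductorNorm ℤ)) 2) (hg : IsNewformOf W' g)
    (h4 : 2 ^ 2 ∣ W.conductorNorm ℤ) (hM' : 4 ^ 2 ∣ W'.conductorNorm ℤ)
    (hNdvd : W.conductorNorm ℤ ∣ W'.conductorNorm ℤ)
    (hL : W'.conductorNorm ℤ ∣ 4 * W.conductorNorm ℤ)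
    (hiso : IsIsogenous (W.quadraticTwist ((-1 : ℤ) : ℚ)) W') :
    (∀ w ∈ periodLattice g,
      gaussSum (ZMod.χ₄.ringHomComp (Int.castRingHom ℂ)) (ZMod.stdAddChar (N := 4)) / 2 * w ∈
        periodLattice D.f) ∧
    (∀ w ∈ periodLattice D.f,
      gaussSum (ZMod.χ₄.ringHomComp (Int.castRingHom ℂ)) (ZMod.stdAddChar (N := 4)) / 2 * w ∈
        periodLattice g) := by
  haveI : Fact (Nat.Prime 2) := ⟨Nat.prime_two⟩
  haveI : NeZero (4 : ℕ) := ⟨by norm_num⟩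
  haveI : NeZero (1 : ℕ) := ⟨by norm_num⟩
  have hχ : (ZMod.χ₄.ringHomComp (Int.castRingHom ℂ)).IsQuadratic := isQuadratic_χ₄_ringHomComp
  have hprim : DirichletCharacter.IsPrimitive (ZMod.χ₄.ringHomComp (Int.castRingHom ℂ)) :=
    isPrimitive_χ₄_ringHomComp
  have hd0 : ((-1 : ℤ) : ℚ) ≠ 0 := by norm_num
  haveI := W.isElliptic_quadraticTwist hd0
  have h4nat : 4 ∣ W.conductorNorm ℤ := by norm_num at h4; exact h4
  have h2nat : 2 ∣ W.conductorNorm ℤ := dvd_trans (by norm_num) h4nat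
  have h4' : 2 ^ 2 ∣ W'.conductorNorm ℤ := dvd_trans (by norm_num) hM'
  obtain ⟨hngW, hnmW⟩ := not_good_and_not_mult_of_sq_dvd_conductorNorm W h4
  obtain ⟨hngW', hnmW'⟩ := not_good_and_not_mult_of_sq_dvd_conductorNorm W' h4'
  have hW0 : ∀ n : ℕ, 2 ∣ n → W.LFunction n = 0 := fun n hn ↦
    W.LFunction_apply_eq_zero_of_not_good_of_not_mult 2 hngW hnmW hn
  have hW'0 : ∀ n : ℕ, 2 ∣ n → W'.LFunction n = 0 := fun n hn ↦
    W'.LFunction_apply_eq_zero_of_not_good_of_not_mult 2 hngW' hnmW' hn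
  have hodd : ∀ n : ℕ, ¬ 2 ∣ n → (((W.quadraticTwist ((-1 : ℤ) : ℚ)).LFunction n : ℤ) : ℂ) =
      (ZMod.χ₄.ringHomComp (Int.castRingHom ℂ)) n * (W.LFunction n : ℂ) := fun n hn ↦ by
    rw [show ((-1 : ℤ) : ℚ) = -1 by norm_num, W.LFunction_quadraticTwist_neg_one_apply_of_odd hn,
      Int.cast_mul, χ₄_ringHomComp_apply_natCast]
  have heven : ∀ n : ℕ, 2 ∣ n → (ZMod.χ₄.ringHomComp (Int.castRingHom ℂ)) n = 0 := fun n hn ↦ by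
    rw [χ₄_ringHomComp_apply_natCast, ZMod.χ₄_nat_eq_if_mod_four, if_pos (Nat.mod_eq_zero_of_dvd hn)]
    simp
  have hsq : ∀ n : ℕ, ¬ 2 ∣ n → (ZMod.χ₄.ringHomComp (Int.castRingHom ℂ)) n *
      (ZMod.χ₄.ringHomComp (Int.castRingHom ℂ)) n = 1 := fun n hn ↦ by
    rw [χ₄_ringHomComp_apply_natCast, ZMod.χ₄_nat_eq_if_mod_four,
      if_neg (fun h ↦ hn (Nat.dvd_of_mod_eq_zero h))]
    split_ifs <;> push_cast <;> ring
  have hLC : (W.quadraticTwist ((-1 : ℤ) : ℚ)).LFunction = W'.LFunction := hiso.LFunction_eq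
  have hcoef : ∀ n : ℕ, cuspCoeff g n =
      (ZMod.χ₄.ringHomComp (Int.castRingHom ℂ)) n * cuspCoeff D.f n := fun n ↦ by
    rw [hg.2 n, D.isNewformOf.2 n]
    by_cases h2 : 2 ∣ n
    · rw [hW'0 n h2, heven n h2]
      simp
    · rw [← hLC]
      exact hodd n h2
  have hevenD : ∀ n : ℕ, 2 ∣ n → cuspCoeff D.f n = 0 := fun n hn ↦ by
    rw [D.isNewformOf.2 n, hW0 n hn, Int.cast_zero]
  have hevenD' : ∀ n : ℕ, 2 ∣ n → cuspCoeff g n = 0 := fun n hn ↦ by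
    rw [hg.2 n, hW'0 n hn, Int.cast_zero]
  -- `g = f_W ⊗ χ₄` at level `N(W′)`
  have htw' : charTwist (W'.conductorNorm ℤ) hNdvd hM' hχ D.f = g :=
    eq_of_forall_cuspCoeff_eq_gamma0 fun n ↦ by rw [cuspCoeff_charTwist _ hNdvd hM' hχ hprim, hcoef n]
  have hhalf : ∀ x : ℚ, modularSymbol D.f (x + 1 / 2) = -modularSymbol D.f x :=
    maninLocalTwoThree_modularSymbol_add_half_eq_neg_of_four_dvd D.f h4nat hevenD
  have hhalf' : ∀ x : ℚ, modularSymbol g (x + 1 / 2) = -modularSymbol g x :=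
    modularSymbol_add_half_eq_neg g hM' hevenD'
  have hm1 : 1 ^ 2 ∣ W'.conductorNorm ℤ := by rw [one_pow]; exact one_dvd _
  have hone : ∀ n : ℕ, (1 : DirichletCharacter ℂ 1) n = 1 := fun n ↦
    MulChar.one_apply (isUnit_of_subsingleton _)
  have hlift : charTwist (W'.conductorNorm ℤ) dvd_rfl hM' hχ g =
      charTwist (W'.conductorNorm ℤ) hNdvd hm1 maninLocalTwoThree_isQuadratic_one_level_one D.f :=
    eq_of_forall_cuspCoeff_eq_gamma0 fun n ↦ by
      rw [cuspCoeff_charTwist _ dvd_rfl hM' hχ hprim, cuspCoeff_charTwist _ hNdvd hm1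
        maninLocalTwoThree_isQuadratic_one_level_one DirichletCharacter.isPrimitive_one_level_one,
        hone n, one_mul, hcoef n, ← mul_assoc]
      by_cases hn : 2 ∣ n
      · rw [hevenD n hn, mul_zero]
      · rw [hsq n hn, one_mul]
  -- level-lift step: the tree's S-an-56 (p2 g13, p693677) for the level-`N′` lift of `f_W`, which `hlift`
  -- identifies with `g ⊗ χ₄` (same re-routing as the typer's B3; the modular-symbol identity behind it is
  -- `modularSymbol (g ⊗ χ₄) = modularSymbol f_W`, by `hlift` + `maninLocalTwoThree_modularSymbol_charTwist_one`).
  have hle : periodLattice D.f ≤ periodLattice (charTwist (W'.conductorNorm ℤ) dvd_rfl hM' hχ g) := by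
    rw [hlift]
    exact ManinLocalTwoThree.periodLattice_le_periodLattice_charTwist_one_of_two_dvd
      (W'.conductorNorm ℤ) hNdvd hL hm1 h2nat D.f
  refine ⟨fun w hw ↦ ?_, fun w hw ↦ ?_⟩
  · rw [← htw'] at hw
    exact half_gaussSum_mul_mem_periodLattice_of_mem_charTwist _ hNdvd hM' hχ hprim D.f
      (fun x ↦ ⟨1, 3, 0, sum_χ₄_modularSymbol_of_half D.f hhalf x⟩) hw
  · exact half_gaussSum_mul_mem_periodLattice_of_mem_charTwist _ dvd_rfl hM' hχ hprim g
      (fun x ↦ ⟨1, 3, 0, sum_χ₄_modularSymbol_of_half g hhalf' x⟩) (hle hw)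

/-- **GENERAL `χ₋₄` ROTATION (data form)**: `Λ(f_{W′}) = i·Λ(f_W)` under the four divisibilities. Subsumes the
tree's THEOREM I `MinusOneTwistLatticeRotation` (`N′ = N`, `16 ∣ N`), E-an-145 (`N′ = 4N`, `4 ∣ N`) and gives
E-an-148 (`N′ = 2N`, `8 ∣ N`). -/
theorem minusOneTwistRotation_general {W W' : WeierstrassCurve ℚ}
    [W.IsElliptic] [W'.IsElliptic] [NeZero (W.conductorNorm ℤ)] [NeZero (W'.conductorNorm ℤ)]
    (D : ModularParametrizationData W (W.conductorNorm ℤ))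
    (D' : ModularParametrizationData W' (W'.conductorNorm ℤ))
    (h4 : 2 ^ 2 ∣ W.conductorNorm ℤ) (hM' : 4 ^ 2 ∣ W'.conductorNorm ℤ)
    (hNdvd : W.conductorNorm ℤ ∣ W'.conductorNorm ℤ)
    (hL : W'.conductorNorm ℤ ∣ 4 * W.conductorNorm ℤ)
    (hiso : IsIsogenous (W.quadraticTwist ((-1 : ℤ) : ℚ)) W') :
    ∀ z : ℂ, z ∈ periodLattice D'.f ↔ Complex.I * z ∈ periodLattice D.f := by
  intro z
  obtain ⟨h₁, h₂⟩ := half_gaussSum_χ₄_twoSided_general D D'.f D'.isNewformOf h4 hM' hNdvd hL hiso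
  have hs : (gaussSum (ZMod.χ₄.ringHomComp (Int.castRingHom ℂ)) (ZMod.stdAddChar (N := 4)) / 2) ^ 2 =
      Complex.I ^ 2 := by
    rw [div_pow, gaussSum_χ₄_ringHomComp_sq, Complex.I_sq]; norm_num
  rcases sq_eq_sq_iff_eq_or_eq_neg.mp hs with hI | hI
  · constructor
    · intro hz
      have := h₁ z hz
      rwa [hI] at this
    · intro hz
      have := h₂ _ hz
      rw [hI, ← mul_assoc, Complex.I_mul_I, neg_one_mul] at this
      exact neg_mem_iff.mp this
  · constructor
    · intro hz
      have := h₁ z hz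
      rw [hI, neg_mul] at this
      exact neg_mem_iff.mp this
    · intro hz
      have := h₂ _ hz
      rw [hI, neg_mul, ← mul_assoc, Complex.I_mul_I, neg_one_mul, neg_neg] at this
      exact this

/-- **GENERAL OPTIMAL ORBIT**: under the four divisibilities, for LATTICE-OPTIMAL data optimality commutes
(`W′ ≅ W ⊗ χ₋₄` over `ℚ`) and `c′ = ±c` (tree edges `optimalTwistRigidity_of_rot`,
`optimal_c_eq_or_of_rot_of_four_dvd`, both level-agnostic; Connell–Pal `Δ′ = Δ`). -/
theorem minusOneTwistOptimalOrbit_general {W W' : WeierstrassCurve ℚ}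
    [W.IsElliptic] [W.IsGloballyMinimal] [W'.IsElliptic] [W'.IsGloballyMinimal]
    [NeZero (W.conductorNorm ℤ)] [NeZero (W'.conductorNorm ℤ)]
    (D : ModularParametrizationData W (W.conductorNorm ℤ))
    (D' : ModularParametrizationData W' (W'.conductorNorm ℤ))
    (hD : IsLatticeOptimal D) (hD' : IsLatticeOptimal D')
    (h4 : 2 ^ 2 ∣ W.conductorNorm ℤ) (hM' : 4 ^ 2 ∣ W'.conductorNorm ℤ)
    (hNdvd : W.conductorNorm ℤ ∣ W'.conductorNorm ℤ)
    (hL : W'.conductorNorm ℤ ∣ 4 * W.conductorNorm ℤ)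
    (hiso : IsIsogenous (W.quadraticTwist ((-1 : ℤ) : ℚ)) W') :
    (∃ u : VariableChange ℚ, u • W.quadraticTwist ((-1 : ℤ) : ℚ) = W') ∧ (D'.c = D.c ∨ D'.c = -D.c) := by
  have hrot := minusOneTwistRotation_general D D' h4 hM' hNdvd hL hiso
  have h4' : 2 ^ 2 ∣ W'.conductorNorm ℤ := dvd_trans ⟨4, by norm_num⟩ hM'
  exact ⟨optimalTwistRigidity_of_rot D D' hD hD' hrot,
    optimal_c_eq_or_of_rot_of_four_dvd D D' hD hD' hrot h4 h4'⟩

/-- THEOREM I's lattice rotation RE-DERIVED from the general law (same conductor, `16 ∣ N`). -/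
theorem minusOneTwistRotation_sameLevel {W W' : WeierstrassCurve ℚ}
    [W.IsElliptic] [W'.IsElliptic] [NeZero (W.conductorNorm ℤ)] [NeZero (W'.conductorNorm ℤ)]
    (D : ModularParametrizationData W (W.conductorNorm ℤ))
    (D' : ModularParametrizationData W' (W'.conductorNorm ℤ))
    (h16 : 2 ^ 4 ∣ W.conductorNorm ℤ) (hN : W'.conductorNorm ℤ = W.conductorNorm ℤ)
    (hiso : IsIsogenous (W.quadraticTwist ((-1 : ℤ) : ℚ)) W') :
    ∀ z : ℂ, z ∈ periodLattice D'.f ↔ Complex.I * z ∈ periodLattice D.f :=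
  minusOneTwistRotation_general D D' (dvd_trans ⟨4, by norm_num⟩ h16)
    (by rw [hN]; simpa using h16) (by rw [hN]) (by rw [hN]; exact Dvd.intro_left 4 rfl) hiso

-- (typer g17: an's `minusOneTwistRotation_fourMul` — E-an-145's rotation re-derived from the general law — is
-- omitted: its statement is p2's landed `ManinLocalTwoThree.mem_periodLattice_iff_I_mul_mem_of_levelRaising`
-- (p693677) verbatim, `dedup.landed`.)

end GeneralRotation

section LevelRaisingByTwo

/-- **Candidate E-an-148 `MinusOneLevelRaisingByTwoLatticeRotation` (NEW; nothing asserted).** On the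
level-raising `χ₋₄`-orbit `8 ∣ N(W)`, `N(W′) = 2N(W)` (the fate of EVERY `8 ∥ N` class: 168 136/168 136),
`W ⊗ χ₋₄ ~ W′`, ANY `Γ₀`-data at the conductors: `Λ(f_{W′}) = i·Λ(f_W)`. -/
def MinusOneLevelRaisingByTwoLatticeRotation : Prop :=
  ∀ (W W' : WeierstrassCurve ℚ) [W.IsElliptic] [W'.IsElliptic] [W.IsGloballyMinimal]
    [W'.IsGloballyMinimal] [NeZero (W.conductorNorm ℤ)] [NeZero (W'.conductorNorm ℤ)]
    (D : ModularParametrizationData W (W.conductorNorm ℤ))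
    (D' : ModularParametrizationData W' (W'.conductorNorm ℤ)),
    2 ^ 3 ∣ W.conductorNorm ℤ → W'.conductorNorm ℤ = 2 * W.conductorNorm ℤ →
    IsIsogenous (W.quadraticTwist ((-1 : ℤ) : ℚ)) W' →
    ∀ z : ℂ, z ∈ periodLattice D'.f ↔ Complex.I * z ∈ periodLattice D.f

/-- **Candidate E-an-148R `MinusOneLevelRaisingByTwoOptimalOrbit`**: same orbit, lattice-optimal data:
optimality commutes and `c′ = ±c`.  Census (in-range `(3,4)` pairs): 85 778/85 778 commuting, `Δ′ = Δ`. -/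
def MinusOneLevelRaisingByTwoOptimalOrbit : Prop :=
  ∀ (W W' : WeierstrassCurve ℚ) [W.IsElliptic] [W'.IsElliptic] [W.IsGloballyMinimal]
    [W'.IsGloballyMinimal] [NeZero (W.conductorNorm ℤ)] [NeZero (W'.conductorNorm ℤ)]
    (D : ModularParametrizationData W (W.conductorNorm ℤ))
    (D' : ModularParametrizationData W' (W'.conductorNorm ℤ)),
    IsLatticeOptimal D → IsLatticeOptimal D' →
    2 ^ 3 ∣ W.conductorNorm ℤ → W'.conductorNorm ℤ = 2 * W.conductorNorm ℤ →
    IsIsogenous (W.quadraticTwist ((-1 : ℤ) : ℚ)) W' →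
    (∃ u : VariableChange ℚ, u • W.quadraticTwist ((-1 : ℤ) : ℚ) = W') ∧ (D'.c = D.c ∨ D'.c = -D.c)

/-- Arithmetic of the `8 ∥ N ⇝ 2N` regime: `4 ∣ M`, `16 ∣ M′`, `M ∣ M′`, `M′ ∣ 4M`. -/
private theorem byTwo_divisibilities {M M' : ℕ} (h8 : 2 ^ 3 ∣ M) (hN : M' = 2 * M) :
    2 ^ 2 ∣ M ∧ 4 ^ 2 ∣ M' ∧ M ∣ M' ∧ M' ∣ 4 * M := by
  refine ⟨dvd_trans ⟨2, by norm_num⟩ h8, ?_, ?_, ?_⟩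
  · rw [hN]; obtain ⟨k, hk⟩ := h8; exact ⟨k, by rw [hk]; ring⟩
  · rw [hN]; exact Dvd.intro_left 2 rfl
  · rw [hN]; exact ⟨2, by ring⟩

/-- **E-an-148 is a THEOREM.** -/
theorem minusOneLevelRaisingByTwoLatticeRotation_holds : MinusOneLevelRaisingByTwoLatticeRotation := by
  intro W W' _ _ _ _ _ _ D D' h8 hN hiso
  obtain ⟨h4, hM', hNdvd, hL⟩ := byTwo_divisibilities h8 hN
  exact minusOneTwistRotation_general D D' h4 hM' hNdvd hL hiso

/-- **E-an-148R is a THEOREM.** -/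
theorem minusOneLevelRaisingByTwoOptimalOrbit_holds : MinusOneLevelRaisingByTwoOptimalOrbit := by
  intro W W' _ _ _ _ _ _ D D' hD hD' h8 hN hiso
  obtain ⟨h4, hM', hNdvd, hL⟩ := byTwo_divisibilities h8 hN
  exact minusOneTwistOptimalOrbit_general D D' hD hD' h4 hM' hNdvd hL hiso

/-- `2 ∤ c ⟺ 2 ∤ c′` across the `8 ∣ N ⇝ 2N` orbit (lattice-optimal data), unconditionally. -/
theorem levelRaisingByTwo_two_not_dvd_c_iff {W W' : WeierstrassCurve ℚ}
    [W.IsElliptic] [W.IsGloballyMinimal] [W'.IsElliptic] [W'.IsGloballyMinimal]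
    [NeZero (W.conductorNorm ℤ)] [NeZero (W'.conductorNorm ℤ)]
    (D : ModularParametrizationData W (W.conductorNorm ℤ))
    (D' : ModularParametrizationData W' (W'.conductorNorm ℤ))
    (hD : IsLatticeOptimal D) (hD' : IsLatticeOptimal D') (h8 : 2 ^ 3 ∣ W.conductorNorm ℤ)
    (hN : W'.conductorNorm ℤ = 2 * W.conductorNorm ℤ)
    (hiso : IsIsogenous (W.quadraticTwist ((-1 : ℤ) : ℚ)) W') :
    ¬ (2 : ℤ) ∣ D.c ↔ ¬ (2 : ℤ) ∣ D'.c := by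
  obtain ⟨-, hc | hc⟩ := minusOneLevelRaisingByTwoOptimalOrbit_holds W W' D D' hD hD' h8 hN hiso
  · rw [hc]
  · rw [hc, dvd_neg]

end LevelRaisingByTwo

end Summit.BirchSwinnertonDyer.Rank1Residual.ManinAdditive

end
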